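import Mathlib
import Summits.FinalStateConjecture.FinalStateConjecture.Theorems.EternalPapapetrouSchwarzschildExteriorModeRigiditySphereReduce
import Summits.FinalStateConjecture.FinalStateConjecture.Theorems.EternalPapapetrouSchwarzschildExteriorModeRigiditySpectral
import HarnessLib

/-!
# Route EternalPapapetrou · SchwarzschildExteriorModeRigidity — vanishing of the time derivative
# of the spherical projections

Helper file for item stmt-FinalStateConjecture-10039 (`SchwarzschildExteriorModeRigidity`).

For `Φ` of class `C²` on the exterior `{‖x⃗‖ > 2M}` solving the Schwarzschild wave equation in
Kerr–Schild coordinates (frame form), bounded with bounded derivative and non-radiating, the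
projections `u = ∫ G(θ) Φ(t, rθ) dσ(θ)` on the eigenfunctions of the spherical Laplacian have
`∂ₜ u = 0` (`fderiv_time_eq_zero` applied to the `Unit`-valued wrapper of `u`, which solves the
reduced system `sphereMean_pde`): `∫ G(θ) ∂ₜΦ(t, rθ) dσ(θ) = 0`
(`integral_eigenfun_mul_timeDeriv_eq_zero`). [folklore]
-/

set_option linter.dupNamespace false

noncomputable section

namespace Summit.FinalStateConjecture.FinalStateConjecture.Theorems

open MeasureTheory Set Filter Topology Metric Literature.Geometry.Lorentzian
  Literature.Analysis.Calculus Literature.Analysis.FluidPDE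

namespace EternalPapapetrou.ModeRigidity

/-! ### The `Unit`-valued wrapper (the `1+1` layer is stated for `ι → ℝ`-valued functions) -/

section Wrapper

variable {P : Type*} [NormedAddCommGroup P] [NormedSpace ℝ P]

/-- `D(q ↦ (u q)_{Unit})(p) v = (Du(p) v)_{Unit}` (both sides vanish if `u` is not differentiable).
[folklore] -/
theorem fderiv_constPi_apply (u : P → ℝ) (p v : P) :
    fderiv ℝ (fun q (_ : Unit) ↦ u q) p v = fun _ ↦ fderiv ℝ u p v := by
  by_cases h : DifferentiableAt ℝ u p
  · rw [fderiv_pi fun _ ↦ h]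
    rfl
  · have h' : ¬DifferentiableAt ℝ (fun q (_ : Unit) ↦ u q) p := fun h' ↦
      h (differentiableAt_pi.1 h' ())
    rw [fderiv_zero_of_not_differentiableAt h, fderiv_zero_of_not_differentiableAt h']
    rfl

/-- The same, as an equality of functions of `p`. [folklore] -/
theorem fderiv_constPi_apply_fun (u : P → ℝ) (v : P) :
    (fun p ↦ fderiv ℝ (fun q (_ : Unit) ↦ u q) p v) = fun p (_ : Unit) ↦ fderiv ℝ u p v :=
  funext fun p ↦ fderiv_constPi_apply u p v

end Wrapper

/-! ### Vanishing of the time derivative of the projections -/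

section Vanish

variable {M : ℝ} (hM : 0 < M) {Φ : E4 → ℝ} (hΦ : ContDiffOn ℝ 2 Φ {x : E4 | 2 * M < ‖E4.spatial x‖})
  (hW : ∀ x : E4, 2 * M < ‖E4.spatial x‖ →
    ∑ μ, ∑ ν, Kerr.inverseMetric M 0 x μ ν *
        fderiv ℝ (fderiv ℝ Φ) x (E4.basisVector μ) (E4.basisVector ν) +
      ∑ ν, Kerr.divInverseMetric M 0 x ν * fderiv ℝ Φ x (E4.basisVector ν) = 0)
  {C : ℝ} (hbΦ : ∀ x : E4, 2 * M < ‖E4.spatial x‖ → |Φ x| ≤ C ∧ ‖fderiv ℝ Φ x‖ ≤ C)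
  (hradΦ : ∀ δ > (0 : ℝ), ∃ R', ∀ x : E4, 2 * M < ‖E4.spatial x‖ → R' < ‖E4.spatial x‖ →
    |fderiv ℝ Φ x (E4.basisVector 0)| * ‖E4.spatial x‖ ≤ δ)
  {K : ℕ} (a : Fin (MvPoly.HomL2.dim 3 K))

omit hM in
/-- A bound for the weight on the sphere. [folklore] -/
theorem exists_bound_Gf : ∃ B, 0 ≤ B ∧ ∀ θ : S2, |(MvPoly.HomL2.eigenfun (K := K) two_le_three a) θ| ≤ B := by
  obtain ⟨B, hB⟩ := (isCompact_univ (X := S2)).exists_bound_of_continuousOn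
    ((continuous_Gf a).comp continuous_subtype_val).continuousOn
  exact ⟨max B 0, le_max_right _ _, fun θ ↦
    ((Real.norm_eq_abs _).symm.le.trans (hB θ (mem_univ _))).trans (le_max_left _ _)⟩

omit hM in
/-- `|∫ G f| ≤ B D (volume : Measure E3).toSphere.real (univ : Set S2)` when `|G| ≤ B`, `|f| ≤ D`. [folklore] -/
theorem abs_integral_mul_le {G f : S2 → ℝ} {B D : ℝ} (hB : ∀ θ, |G θ| ≤ B) (hD : ∀ θ, |f θ| ≤ D)
    (hB0 : 0 ≤ B) :
    |∫ θ : S2, G θ * f θ ∂(volume : Measure E3).toSphere| ≤ B * D * (volume : Measure E3).toSphere.real (univ : Set S2) := by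
  have h := norm_integral_le_of_norm_le_const (μ := (volume : Measure E3).toSphere)
    (f := fun θ : S2 ↦ G θ * f θ) (C := B * D) (Eventually.of_forall fun θ ↦ by
      rw [Real.norm_eq_abs, abs_mul]
      exact mul_le_mul (hB θ) (hD θ) (abs_nonneg _) hB0)
  rwa [Real.norm_eq_abs] at h

include hM hΦ hW hbΦ hradΦ in
/-- **The time derivative of the projections vanishes**: `∂ₜ ∫ G(θ) Φ(t, rθ) dσ(θ) = 0` on the
strip, by `fderiv_time_eq_zero` applied to the `Unit`-valued wrapper of the projection.
[folklore] -/
theorem fderiv_sphereMean_e₁_eq_zero : ∀ p ∈ strip M, fderiv ℝ (sphereMean (MvPoly.HomL2.eigenfun (K := K) two_le_three a) Φ) p e₁ = 0 := by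
  have h2M : 0 < 2 * M := by linarith
  have hO := isOpen_exteriorSet M
  have hΩ : IsOpen (strip M) := isOpen_strip M
  have hmaps : ∀ q ∈ strip M, ∀ θ : S2, spt q θ ∈ {x : E4 | 2 * M < ‖E4.spatial x‖} :=
    fun q hq θ ↦ spt_mem_exteriorSet hq θ
  have hG : Continuous (MvPoly.HomL2.eigenfun (K := K) two_le_three a) := continuous_Gf a
  obtain ⟨B, hB0, hB⟩ := exists_bound_Gf a
  set u : ℝ × ℝ → ℝ := sphereMean (MvPoly.HomL2.eigenfun (K := K) two_le_three a) Φ with hu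
  set lam := MvPoly.HomL2.eigenlam (K := K) two_le_three a with hlam
  have huC : ContDiffOn ℝ 2 u (strip M) := contDiffOn_sphereMean hO hΦ hG hΩ hmaps
  -- the wrapper
  set U : ℝ × ℝ → Unit → ℝ := fun q _ ↦ u q with hU
  have hUC : ContDiffOn ℝ 2 U (strip M) := contDiffOn_pi.2 fun _ ↦ huC
  have hU1 : ∀ (p v : ℝ × ℝ), fderiv ℝ U p v = fun _ ↦ fderiv ℝ u p v :=
    fun p v ↦ fderiv_constPi_apply u p v
  have hU2 : ∀ (p v w : ℝ × ℝ), fderiv ℝ (fun q ↦ fderiv ℝ U q v) p w =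
      fun _ ↦ fderiv ℝ (fun q ↦ fderiv ℝ u q v) p w := by
    intro p v w
    rw [show (fun q ↦ fderiv ℝ U q v) = fun q (_ : Unit) ↦ fderiv ℝ u q v from
      fderiv_constPi_apply_fun u v]
    exact fderiv_constPi_apply _ p w
  set Λ : (Unit → ℝ) →L[ℝ] (Unit → ℝ) := (-lam) • ContinuousLinearMap.id ℝ (Unit → ℝ) with hΛ
  -- the reduced system
  have hpde : ∀ p ∈ strip M, rwOp M Λ p.2 (U p) (fderiv ℝ U p e₁) (fderiv ℝ U p e₂)
      (fderiv ℝ (fun q ↦ fderiv ℝ U q e₁) p e₁) (fderiv ℝ (fun q ↦ fderiv ℝ U q e₁) p e₂)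
      (fderiv ℝ (fun q ↦ fderiv ℝ U q e₂) p e₂) = 0 := by
    intro p hp
    have h := sphereMean_pde hM hΦ hW a hp
    rw [hU1, hU1, hU2, hU2, hU2]
    funext i
    simp only [rwOp, hΛ, hU, Pi.add_apply, Pi.smul_apply, smul_eq_mul,
      FunLike.coe_smul, ContinuousLinearMap.coe_id', id_eq, Pi.zero_apply]
    simp only [hu]
    linear_combination h
  -- bounds
  have hbd : ∀ p ∈ strip M, |u p| ≤ B * C * (volume : Measure E3).toSphere.real (univ : Set S2) ∧ |fderiv ℝ u p e₁| ≤ B * C * (volume : Measure E3).toSphere.real (univ : Set S2) ∧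
      |fderiv ℝ u p e₂| ≤ B * C * (volume : Measure E3).toSphere.real (univ : Set S2) := by
    intro p hp
    refine ⟨?_, ?_, ?_⟩
    · exact abs_integral_mul_le hB (fun θ ↦ (hbΦ _ (hmaps p hp θ)).1) hB0
    · rw [fderiv_sphereMean_apply hO hΦ hG hΩ hmaps hp]
      simp only [sembed_e₁]
      refine abs_integral_mul_le hB (fun θ ↦ ?_) hB0
      calc |fderiv ℝ Φ (spt p θ) (E4.basisVector 0)|
          ≤ ‖fderiv ℝ Φ (spt p θ)‖ * ‖E4.basisVector 0‖ := by
            rw [← Real.norm_eq_abs]; exact ContinuousLinearMap.le_opNorm _ _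
        _ ≤ C * 1 := by
            refine mul_le_mul (hbΦ _ (hmaps p hp θ)).2 ?_ (norm_nonneg _)
              ((abs_nonneg _).trans (hbΦ _ (hmaps p hp θ)).1)
            rw [PiLp.norm_single, norm_one]
        _ = C := mul_one C
    · rw [fderiv_sphereMean_apply hO hΦ hG hΩ hmaps hp]
      simp only [sembed_e₂]
      refine abs_integral_mul_le hB (fun θ ↦ ?_) hB0
      calc |fderiv ℝ Φ (spt p θ) (E4.spaceEmbed (θ : E3))|
          ≤ ‖fderiv ℝ Φ (spt p θ)‖ * ‖E4.spaceEmbed (θ : E3)‖ := by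
            rw [← Real.norm_eq_abs]; exact ContinuousLinearMap.le_opNorm _ _
        _ ≤ C * 1 := by
            refine mul_le_mul (hbΦ _ (hmaps p hp θ)).2 ?_ (norm_nonneg _)
              ((abs_nonneg _).trans (hbΦ _ (hmaps p hp θ)).1)
            rw [norm_spaceEmbed_sphere θ]
        _ = C := mul_one C
  have hbU : ∀ p ∈ strip M, ‖U p‖ ≤ B * C * (volume : Measure E3).toSphere.real (univ : Set S2) ∧ ‖fderiv ℝ U p e₁‖ ≤ B * C * (volume : Measure E3).toSphere.real (univ : Set S2) ∧
      ‖fderiv ℝ U p e₂‖ ≤ B * C * (volume : Measure E3).toSphere.real (univ : Set S2) := by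
    intro p hp
    obtain ⟨h0, h1, h2⟩ := hbd p hp
    refine ⟨?_, ?_, ?_⟩
    · rw [hU]; simpa using h0
    · rw [hU1]; simpa using h1
    · rw [hU1]; simpa using h2
  -- non-radiation
  have hradU : ∀ δ > (0 : ℝ), ∃ R₀, ∀ p ∈ strip M, R₀ ≤ p.2 → p.2 * ‖fderiv ℝ U p e₁‖ ≤ δ := by
    intro δ hδ
    have hσ : 0 ≤ (volume : Measure E3).toSphere.real (univ : Set S2) := measureReal_nonneg
    have hden : 0 < B * (volume : Measure E3).toSphere.real (univ : Set S2) + 1 :=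
      add_pos_of_nonneg_of_pos (mul_nonneg hB0 hσ) one_pos
    obtain ⟨R', hR'⟩ := hradΦ (δ / (B * (volume : Measure E3).toSphere.real (univ : Set S2) + 1))
      (div_pos hδ hden)
    refine ⟨R' + 1, fun p hp hRp ↦ ?_⟩
    have hr : 0 < p.2 := lt_trans h2M hp.2
    rw [hU1, pi_norm_const, Real.norm_eq_abs, fderiv_sphereMean_apply hO hΦ hG hΩ hmaps hp]
    simp only [sembed_e₁]
    have hpt : ∀ θ : S2, |fderiv ℝ Φ (spt p θ) (E4.basisVector 0)| ≤ δ / (B * (volume : Measure E3).toSphere.real (univ : Set S2) + 1) / p.2 := by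
      intro θ
      rw [le_div_iff₀ hr]
      have h := hR' (spt p θ) (hmaps p hp θ) (by rw [norm_spatial_spt hr θ]; linarith)
      rwa [norm_spatial_spt hr θ] at h
    have h := abs_integral_mul_le hB hpt hB0
    calc p.2 * |∫ θ : S2, (MvPoly.HomL2.eigenfun (K := K) two_le_three a) θ * fderiv ℝ Φ (spt p θ) (E4.basisVector 0)
          ∂(volume : Measure E3).toSphere|
        ≤ p.2 * (B * (δ / (B * (volume : Measure E3).toSphere.real (univ : Set S2) + 1) / p.2) * (volume : Measure E3).toSphere.real (univ : Set S2)) := by gcongr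
      _ = B * (volume : Measure E3).toSphere.real (univ : Set S2) / (B * (volume : Measure E3).toSphere.real (univ : Set S2) + 1) * δ := by field_simp
      _ ≤ 1 * δ := by
          gcongr
          rw [div_le_one hden]
          linarith
      _ = δ := one_mul δ
  -- the `1+1` theorem
  intro p hp
  have h := fderiv_time_eq_zero hM Λ U hUC hpde hbU hradU p hp
  rw [hU1] at h
  exact congrFun h ()

include hM hΦ hW hbΦ hradΦ in
/-- **The projections of `∂ₜΦ` on the eigenfunctions vanish**:
`∫ G(θ) ∂ₜΦ(t, rθ) dσ(θ) = 0`. [folklore] -/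
theorem integral_eigenfun_mul_timeDeriv_eq_zero {p : ℝ × ℝ} (hp : p ∈ strip M) :
    ∫ θ : S2, (MvPoly.HomL2.eigenfun (K := K) two_le_three a) θ * fderiv ℝ Φ (spt p θ) (E4.basisVector 0)
      ∂(volume : Measure E3).toSphere = 0 := by
  have h := fderiv_sphereMean_e₁_eq_zero hM hΦ hW hbΦ hradΦ a p hp
  rw [fderiv_sphereMean_apply (isOpen_exteriorSet M) hΦ (continuous_Gf a) (isOpen_strip M)
    (fun q hq θ ↦ spt_mem_exteriorSet hq θ) hp] at h
  simpa only [sembed_e₁] using h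

end Vanish

end EternalPapapetrou.ModeRigidity

end Summit.FinalStateConjecture.FinalStateConjecture.Theorems
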